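import Summits.ResolutionOfSingularities.ResolutionOfSingularities.Theorems.MarkedTransferCampaignW46MohWindowSurfaceOriginChart
import HarnessLib

/-!
# [OURS · L1 W4.6 rung (iii-2), EVERY `p`] Surface Moh window — THE STALLING THREAD IN ORIGIN CHARTS: along an infinite in-regime sequence,
# infinitely often the thread child is the ORIGIN of the `x`-chart of a HEAVY NORMAL FORM presentation of the centre (cell res-hironaka,
# LADDER-RESOLUTION rung L, D-0089; seat res-L1-s46-pv-5 gen 5; host MarkedTransfer, `--supports stmt-ResolutionOfSingularities-16155
# --as helper`; statement file `…CampaignW46MohWindowSurface.lean`)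

HONEST FRAMING. Nothing here is a statement of H. Hironaka's manuscript [Hironaka2017] and nothing here asserts that any
statement of it holds. THEOREM about the OURS regime `CampaignW46.Regime.mohWindowSurface` (o1 §5; every `p`, every `K`): the thread form of
`exists_originChart_of_le_residualOrder` (`…OriginChart.lean`) along `PermissibleRun.exists_stalling_thread` (`…StallThread.lean`). This is
the scheme-level statement «an infinite in-regime sequence produces infinitely many stall/growth steps `(x, y, z) ↦ (x, y/x, z/x)` at the
origin over a HEAVY point `z^p + Σ_{i ≥ p} a_i x^{d−i} y^i (mod 𝔪)`» that the non-tame rung for `p ≥ 3` must exclude, and the input of a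
formal-coordinates entrance door. AI-written; AI review is weaker than expert review. No `sorry`; axioms standard.
[ZariskiSamuel1960] [Matsumura1987] [HauserWagner2014] [CossartPiltant2008]
-/

noncomputable section

set_option linter.dupNamespace false -- mandated namespace of this single-conjunct summit

open CategoryTheory AlgebraicGeometry TopologicalSpace IsLocalRing

namespace Summit.ResolutionOfSingularities.ResolutionOfSingularities.Theorems

namespace CampaignW46

open Literature.AlgebraicGeometry.Resolution
open Literature.AlgebraicGeometry.Hironaka2017.S02Preliminaries
open Literature.AlgebraicGeometry.Hironaka2017.Datum
open Scheme.IdealSheafData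

universe u

variable {p : ℕ} [Fact p.Prime] {K : Type u} [Field K] [CharP K p]

/-- **[OURS · L1 W4.6 rung (iii-2), every `p`] THE STALLING THREAD IN ORIGIN CHARTS.** An infinite §2.1-permissible sequence inside
`Regime.mohWindowSurface` carries a branch of singular points `b` (`b_k ∈ Sing(E_k)`, `π_k b_{k+1} = b_k`) such that for every `k₀` there is a
hit `k ≥ k₀` (`b_k ∈ D_k`) and a coefficient window presentation `c = (x, y, z)` of `𝔪_{b_k}`, `J_{b_k} = (z^p + Σ_{i ≤ d} a_i x^{d−i} y^i)`,
`p < d < 2p`, a unit among the `a_i`, in HEAVY NORMAL FORM (`a_i ∈ 𝔪` for `i < p`), for which `b_{k+1}` IS THE ORIGIN of the Rees chart `x`: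
a chart morphism `q : Spec B_0 → Z_{k+1}` over `Spec 𝒪_{Z_k, b_k}` computing the local ring at a prime `w ∋ x, y/x, z/x` with `q w = b_{k+1}`.
NOT a statement of the manuscript. [folklore] -/
theorem PermissibleRun.exists_stalling_thread_origin (r : PermissibleRun p K)
    (hr : ∀ k, Regime.mohWindowSurface (r.A k) (r.E k)) :
    ∃ b : ∀ k, (r.A k).Z, (∀ k, b k ∈ (r.E k).sing) ∧ (∀ k, (r.π k).base (b (k + 1)) = b k) ∧
      ∀ k₀, ∃ k, k₀ ≤ k ∧ b k ∈ (r.D k : Set (r.A k).Z) ∧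
        ∃ (c : Fin 3 → (r.A k).Z.presheaf.stalk (b k)) (d : ℕ) (a : ℕ → (r.A k).Z.presheaf.stalk (b k)),
          Ideal.span (Set.range c) = maximalIdeal _ ∧ p < d ∧ d < 2 * p ∧ (∃ i ≤ d, IsUnit (a i)) ∧
          (∀ i < p, a i ∈ maximalIdeal _) ∧
          stalkIdeal (r.E k).J (b k) = Ideal.span {c 2 ^ p + ∑ i ∈ Finset.range (d + 1), a i * c 0 ^ (d - i) * c 1 ^ i} ∧
          ∃ (q : Spec (.of (chartRing c 0)) ⟶ (r.A (k + 1)).Z) (w : Spec (.of (chartRing c 0))),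
            q w = b (k + 1) ∧ IsIso (q.stalkMap w) ∧
            q ≫ r.π k = Spec.map (CommRingCat.ofHom (chartBase c 0)) ≫ (r.A k).Z.fromSpecStalk (b k) ∧
            chartBase c 0 (c 0) ∈ w.asIdeal ∧ chartGen c 0 1 ∈ w.asIdeal ∧ chartGen c 0 2 ∈ w.asIdeal := by
  classical
  obtain ⟨b, hbS, hbπ, hstall⟩ := r.exists_stalling_thread hr
  refine ⟨b, hbS, hbπ, fun k₀ => ?_⟩
  obtain ⟨k, hk, hbk, hle, -⟩ := hstall k₀
  refine ⟨k, hk, hbk, ?_⟩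
  -- one step, stated for an arbitrary next stage `E₁ = transform` (dependent rewriting along `E_succ`)
  have key : ∀ (E₁ : IdealExponent (r.A (k + 1)).Z) (heq : E₁ = (r.E k).transform (r.π k) (r.D k))
      (h₁ : Regime.mohWindowSurface (r.A (k + 1)) E₁) (hb₁ : b (k + 1) ∈ E₁.sing)
      (hle₁ : (residualOrder (r.E k).b ((r.A k).Z.presheaf.stalk (b k)) (stalkIdeal (r.E k).J (b k))).toNat ≤
        (residualOrder E₁.b ((r.A (k + 1)).Z.presheaf.stalk (b (k + 1))) (stalkIdeal E₁.J (b (k + 1)))).toNat),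
      ∃ (c : Fin 3 → (r.A k).Z.presheaf.stalk (b k)) (d : ℕ) (a : ℕ → (r.A k).Z.presheaf.stalk (b k)),
        Ideal.span (Set.range c) = maximalIdeal _ ∧ p < d ∧ d < 2 * p ∧ (∃ i ≤ d, IsUnit (a i)) ∧
        (∀ i < p, a i ∈ maximalIdeal _) ∧
        stalkIdeal (r.E k).J (b k) = Ideal.span {c 2 ^ p + ∑ i ∈ Finset.range (d + 1), a i * c 0 ^ (d - i) * c 1 ^ i} ∧
        ∃ (q : Spec (.of (chartRing c 0)) ⟶ (r.A (k + 1)).Z) (w : Spec (.of (chartRing c 0))),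
          q w = b (k + 1) ∧ IsIso (q.stalkMap w) ∧
          q ≫ r.π k = Spec.map (CommRingCat.ofHom (chartBase c 0)) ≫ (r.A k).Z.fromSpecStalk (b k) ∧
          chartBase c 0 (c 0) ∈ w.asIdeal ∧ chartGen c 0 1 ∈ w.asIdeal ∧ chartGen c 0 2 ∈ w.asIdeal := by
    intro E₁ heq h₁ hb₁ hle₁
    subst heq
    exact exists_originChart_of_le_residualOrder (r.π k) (r.blowup k) (r.permissible k) (hr k) h₁ hb₁ (hbπ k) hbk hle₁
  exact key (r.E (k + 1)) (r.E_succ k) (hr (k + 1)) (hbS (k + 1)) hle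

end CampaignW46

end Summit.ResolutionOfSingularities.ResolutionOfSingularities.Theorems

end
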